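import Summits.QuantumAdvantage.AdviceFreeQNC0.DWalkNormalForm
import HarnessLib

/-!
# Cell qa-qnc0 (rung F-Q2-odd, `p = 3`): plan P-15a — `PredHardDWB3 → OneBellDWB3` (two predictors)

Planner qa-qnc0-p1 g16, `ROUND-15.md` §2 / `Sketch19.lean` plan `OneBellOfPred` (statement in `DWalkNormalForm.lean`,
verbatim).  PROVED here:

* the equidistribution count **`three_mul_card_affine_mod_three`**: for coefficients `κ_i ≢ 0 (mod 3)`,
  `|3·#{u ∈ {0,1}ⁿ : c + Σ_i κ_i u_i ≡ r} − 2ⁿ| ≤ 2` (induction on `n`: `#_{n+1}(r) = 2ⁿ − #_n^{c+2κ₀}(r)`);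
* the odd class through the chart `uVec` (`card_odd_filter_le/ge`: injectivity `xOfU_uVec` + `card_even_class_le`),
  the stake as an affine form `k + N + W_k + W_{N-1} = (k + n + 1) + Σ_i κ_i u_i`, `κ_i = 2` (`i < k`), `1` (`i ≥ k`)
  (`stake_eq_affine`), hence **`3·#{x odd : Dk3 x k = 1} + 2 ≥ 2^{N-1}`** (`two_pow_le_three_mul_card_dk3_eq_one`);
* **`oneBellOfPred : OneBellOfPred`**: the two predictors `g_a := 1 + (a − 1)·[w = 1]`, `a ∈ {0, 2}` (`predOf`,
  degree `≤ 2Δ ≤ (log₂ N)^{C+1}`), whose agreement sets on the odd class are `{w = 1, D_k = a} ⊔ {w ≠ 1, D_k = 1}`;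
  summing the two `PredHardDWB3` bounds (at `ε/4`), `#{w = 1, D_k ≠ 1} + 2#{w ≠ 1, D_k = 1} ≤ (2/3)(2^{N-1} + (ε/4)2^N)`,
  and with the count above `3#{w = 1, D_k ≠ 1} ≤ 2#{w = 1} + ε·2^N` once `2^N ≥ 16/ε`.

WHAT THIS IS NOT: `PredHardDWB3` itself (THEOREM A′ of ROUND-15) is NOT proved here; separation NOT moved.
-/

noncomputable section

namespace Summit.QuantumAdvantage.AdviceFreeQNC0

open Classical
open Finset
open Literature.Computability.QuantumComplexity Literature.Computability.QuantumComplexity.RingHLF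
open Literature.Computability.MetaComplexity Literature.Computability.MetaComplexity.Smolensky

variable {N : ℕ}

/-! ### Equidistribution of affine forms mod 3 on the cube -/

/-- `#{u ∈ {0,1}ⁿ : c + Σ_i κ_i u_i ≡ r (mod 3)}`. -/
def affCount (n : ℕ) (κ : Fin n → ℕ) (c r : ℕ) : ℕ :=
  (univ.filter fun u : Fin n → Bool => (c + ∑ i, (if u i = true then κ i else 0)) % 3 = r % 3).card

/-- Splitting off coordinate `0`: `#_{n+1}(c) = #_n(c) + #_n(c + κ₀)`. -/
theorem affCount_succ {n : ℕ} (κ : Fin (n + 1) → ℕ) (c r : ℕ) :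
    affCount (n + 1) κ c r =
      affCount n (fun i => κ i.succ) c r + affCount n (fun i => κ i.succ) (c + κ 0) r := by
  unfold affCount
  rw [Finset.card_filter, Finset.card_filter, Finset.card_filter,
    ← Fintype.sum_equiv (Fin.consEquiv fun _ : Fin (n + 1) => Bool) _ _ (fun _ => rfl),
    Fintype.sum_prod_type, Fintype.sum_bool, add_comm]
  congr 1
  · refine Finset.sum_congr rfl fun v _ => ?_
    simp [Fin.consEquiv, Fin.sum_univ_succ]
  · refine Finset.sum_congr rfl fun v _ => ?_
    simp [Fin.consEquiv, Fin.sum_univ_succ, add_assoc]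

/-- The three shifts `c, c + e, c + 2e` (`e ≢ 0`) partition the cube. -/
theorem affCount_add_three {n : ℕ} (κ : Fin n → ℕ) {e : ℕ} (he : e % 3 ≠ 0) (c r : ℕ) :
    affCount n κ c r + affCount n κ (c + e) r + affCount n κ (c + 2 * e) r = 2 ^ n := by
  unfold affCount
  rw [Finset.card_filter, Finset.card_filter, Finset.card_filter, ← Finset.sum_add_distrib,
    ← Finset.sum_add_distrib]
  have he' : e % 3 = 1 ∨ e % 3 = 2 := by omega
  have key : ∀ S : ℕ, ((if (c + S) % 3 = r % 3 then 1 else 0) + (if (c + e + S) % 3 = r % 3 then 1 else 0) +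
      (if (c + 2 * e + S) % 3 = r % 3 then 1 else 0)) = 1 := by
    intro S
    have hr : r % 3 = 0 ∨ r % 3 = 1 ∨ r % 3 = 2 := by omega
    have hs : (c + S) % 3 = 0 ∨ (c + S) % 3 = 1 ∨ (c + S) % 3 = 2 := by omega
    rcases he' with h | h <;> rcases hr with hr | hr | hr <;> rcases hs with hs | hs | hs <;>
      simp [hr, show (c + S) % 3 = _ from hs, show (c + e + S) % 3 = ((c + S) % 3 + e % 3) % 3 by omega,
        show (c + 2 * e + S) % 3 = ((c + S) % 3 + 2 * (e % 3)) % 3 by omega, h]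
  rw [Finset.sum_congr rfl fun u _ => key _, Finset.sum_const, card_univ, Fintype.card_fun,
    Fintype.card_bool, Fintype.card_fin, smul_eq_mul, mul_one]

/-- **`|3·#{u : c + Σ_i κ_i u_i ≡ r (3)} − 2ⁿ| ≤ 2`** for coefficients `κ_i ≢ 0 (mod 3)`: by `affCount_succ` and
`affCount_add_three`, `#_{n+1}(c) = 2ⁿ − #_n(c + 2κ₀)`, and `|3# − 2ⁿ|` is invariant. -/
theorem three_mul_card_affine_mod_three :
    ∀ (n : ℕ) (κ : Fin n → ℕ), (∀ i, κ i % 3 ≠ 0) → ∀ (c r : ℕ),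
      (2 : ℤ) ^ n - 2 ≤ 3 * (affCount n κ c r : ℤ) ∧ 3 * (affCount n κ c r : ℤ) ≤ (2 : ℤ) ^ n + 2 := by
  intro n
  induction n with
  | zero =>
    intro κ _ c r
    unfold affCount
    by_cases h : c % 3 = r % 3
    · have : (univ.filter fun u : Fin 0 → Bool =>
          (c + ∑ i, (if u i = true then κ i else 0)) % 3 = r % 3) = univ := by
        ext u; simp [h]
      rw [this, card_univ, Fintype.card_fun, Fintype.card_bool, Fintype.card_fin]
      norm_num
    · have : (univ.filter fun u : Fin 0 → Bool =>
          (c + ∑ i, (if u i = true then κ i else 0)) % 3 = r % 3) = ∅ := by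
        ext u; simp [h]
      rw [this, card_empty]
      norm_num
  | succ n ih =>
    intro κ hκ c r
    have h1 := affCount_succ κ c r
    have h2 := affCount_add_three (fun i => κ i.succ) (hκ 0) c r
    obtain ⟨ih1, ih2⟩ := ih (fun i => κ i.succ) (fun i => hκ i.succ) (c + 2 * κ 0) r
    zify at h1 h2
    rw [pow_succ]
    constructor <;> linarith

/-- **`𝔽₃`-coefficient form**: for `η_i ≠ 0` in `𝔽₃` and `c, r ∈ 𝔽₃`,
`|3·#{u : c + Σ_i [u_i] η_i = r} − 2ⁿ| ≤ 2` (from `three_mul_card_affine_mod_three` via `ZMod.val`). -/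
theorem three_mul_card_affine_zmod3 (n : ℕ) (η : Fin n → ZMod 3) (hη : ∀ i, η i ≠ 0) (c r : ZMod 3) :
    (2 : ℤ) ^ n - 2 ≤ 3 * ((univ.filter fun u : Fin n → Bool =>
        c + ∑ i, (if u i = true then η i else 0) = r).card : ℤ) ∧
    3 * ((univ.filter fun u : Fin n → Bool =>
        c + ∑ i, (if u i = true then η i else 0) = r).card : ℤ) ≤ (2 : ℤ) ^ n + 2 := by
  have hκ : ∀ i, (η i).val % 3 ≠ 0 := by
    intro i h
    have hlt : (η i).val < 3 := ZMod.val_lt (η i)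
    have hz : (η i).val = 0 := by omega
    exact hη i ((ZMod.val_eq_zero (η i)).1 hz)
  have h := three_mul_card_affine_mod_three n (fun i => (η i).val) hκ c.val r.val
  unfold affCount at h
  have hset : (univ.filter fun u : Fin n → Bool => c + ∑ i, (if u i = true then η i else 0) = r) =
      univ.filter fun u : Fin n → Bool =>
        (c.val + ∑ i, (if u i = true then (η i).val else 0)) % 3 = r.val % 3 := by
    ext u
    simp only [mem_filter, mem_univ, true_and]
    rw [← ZMod.natCast_eq_natCast_iff', Nat.cast_add, Nat.cast_sum, ZMod.natCast_zmod_val,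
      ZMod.natCast_zmod_val]
    have : (∑ i, ((if u i = true then (η i).val else 0 : ℕ) : ZMod 3)) = ∑ i, (if u i = true then η i else 0) := by
      refine Finset.sum_congr rfl fun i _ => ?_
      split_ifs
      · exact ZMod.natCast_zmod_val (η i)
      · simp
    rw [this]
  rw [hset]
  exact h

/-! ### The odd class in the chart `uVec` -/

section OddClass

variable {n : ℕ}

/-- The odd class of `{0,1}^{n+1}` has at least `2ⁿ` patterns. -/
theorem two_pow_le_card_odd_class :
    2 ^ n ≤ (univ.filter fun x : Fin (n + 1) → Bool =>
      (univ.filter fun j : Fin (n + 1) => x j = false).card % 2 = 1).card := by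
  have htot := Finset.card_filter_add_card_filter_not (s := (univ : Finset (Fin (n + 1) → Bool)))
    (fun x => (univ.filter fun j : Fin (n + 1) => x j = false).card % 2 = 1)
  rw [card_univ, Fintype.card_fun, Fintype.card_bool, Fintype.card_fin, pow_succ] at htot
  have heven := card_even_class_le (n := n)
  omega

/-- **Transfer of counts through the chart**: for any predicate `Q` on walk coordinates, the odd-class patterns
`x` with `Q (uVec x)` are at most `#{u : Q u}` (injectivity of `uVec`, `xOfU_uVec`). -/
theorem card_odd_filter_le (hn : 2 ≤ n) (Q : (Fin n → Bool) → Prop) [DecidablePred Q] :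
    (univ.filter fun x : Fin (n + 1) → Bool =>
      (univ.filter fun j : Fin (n + 1) => x j = false).card % 2 = 1 ∧ Q (uVec x)).card ≤
      (univ.filter fun u : Fin n → Bool => Q u).card := by
  refine Finset.card_le_card_of_injOn uVec ?_ ?_
  · intro x hx
    rw [Finset.mem_coe, mem_filter] at hx
    rw [Finset.mem_coe, mem_filter]
    exact ⟨mem_univ _, hx.2.2⟩
  · intro x₁ hx₁ x₂ hx₂ h
    rw [Finset.mem_coe, mem_filter] at hx₁ hx₂
    rw [← xOfU_uVec hn x₁ hx₁.2.1, ← xOfU_uVec hn x₂ hx₂.2.1, h]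

/-- Hence also a LOWER bound: `#{x odd : Q (uVec x)} + #{u : ¬ Q u} ≥ 2ⁿ`. -/
theorem card_odd_filter_ge (hn : 2 ≤ n) (Q : (Fin n → Bool) → Prop) [DecidablePred Q] :
    2 ^ n ≤ (univ.filter fun x : Fin (n + 1) → Bool =>
      (univ.filter fun j : Fin (n + 1) => x j = false).card % 2 = 1 ∧ Q (uVec x)).card +
      (univ.filter fun u : Fin n → Bool => ¬ Q u).card := by
  have hle : (univ.filter fun x : Fin (n + 1) → Bool =>
      (univ.filter fun j : Fin (n + 1) => x j = false).card % 2 = 1 ∧ ¬ Q (uVec x)).card ≤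
      (univ.filter fun u : Fin n → Bool => ¬ Q u).card := card_odd_filter_le hn (fun u => ¬ Q u)
  have hsub : (univ.filter fun x : Fin (n + 1) → Bool =>
      (univ.filter fun j : Fin (n + 1) => x j = false).card % 2 = 1) ⊆
      (univ.filter fun x : Fin (n + 1) → Bool =>
        (univ.filter fun j : Fin (n + 1) => x j = false).card % 2 = 1 ∧ Q (uVec x)) ∪
      (univ.filter fun x : Fin (n + 1) → Bool =>
        (univ.filter fun j : Fin (n + 1) => x j = false).card % 2 = 1 ∧ ¬ Q (uVec x)) := by
    intro x hx
    rw [mem_filter] at hx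
    rw [mem_union, mem_filter, mem_filter]
    by_cases hQ : Q (uVec x)
    · exact Or.inl ⟨hx.1, hx.2, hQ⟩
    · exact Or.inr ⟨hx.1, hx.2, hQ⟩
  have h1 := le_trans (Finset.card_le_card hsub) (Finset.card_union_le _ _)
  have hodd := two_pow_le_card_odd_class (n := n)
  omega

/-- In the chart, the stake is an affine form: for an odd-class `x` of length `n + 1` and `k ≤ n`,
`k + (n+1) + W_k + W_n = (k + n + 1) + Σ_i κ_i u_i` with `κ_i = 2` (`i < k`), `1` (`i ≥ k`). -/
theorem stake_eq_affine (x : Fin (n + 1) → Bool) {k : ℕ} (hk : k ≤ n) :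
    k + (n + 1) + Wk x k + Wk x (n + 1 - 1) =
      (k + n + 1) + ∑ i : Fin n, (if uVec x i = true then (if i.val < k then 2 else 1) else 0) := by
  rw [show n + 1 - 1 = n from rfl, ← wtPrefix_uVec x hk, ← wt_uVec x]
  unfold wtPrefix wt
  rw [Finset.card_filter, Finset.card_filter, add_assoc (k + (n + 1)), ← Finset.sum_add_distrib]
  have : ∀ i : Fin n, ((if (i.val < k ∧ uVec x i = true) then 1 else 0) +
      (if uVec x i = true then 1 else 0)) =
      (if uVec x i = true then (if i.val < k then 2 else 1) else 0) := by
    intro i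
    by_cases h1 : i.val < k <;> by_cases h2 : uVec x i = true <;> simp [h1, h2]
  rw [Finset.sum_congr rfl fun i _ => this i]
  ring

/-- **`3·#{x odd : Dk3 x k = 1} + 2 ≥ 2^{N-1}`** (`N = n + 1 ≥ 3`). -/
theorem two_pow_le_three_mul_card_dk3_eq_one (hn : 2 ≤ n) (k : Fin (n + 1)) :
    (2 : ℤ) ^ n ≤ 3 * ((univ.filter fun x : Fin (n + 1) → Bool =>
      (univ.filter fun j : Fin (n + 1) => x j = false).card % 2 = 1 ∧ Dk3 x k.val = 1).card : ℤ) + 2 := by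
  have hk : k.val ≤ n := by have := k.isLt; omega
  obtain ⟨κ, hκ⟩ : ∃ κ : Fin n → ℕ, κ = fun i => if i.val < k.val then 2 else 1 := ⟨_, rfl⟩
  have hκ0 : ∀ i, κ i % 3 ≠ 0 := by intro i; rw [hκ]; dsimp only; split_ifs <;> decide
  obtain ⟨Q, hQ⟩ : ∃ Q : (Fin n → Bool) → Prop, Q = fun u =>
    ((k.val + n + 1) + ∑ i : Fin n, (if u i = true then κ i else 0)) % 3 = 2 % 3 := ⟨_, rfl⟩
  -- the odd-class set in question is `{x odd : Q (uVec x)}`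
  have hset : (univ.filter fun x : Fin (n + 1) → Bool =>
      (univ.filter fun j : Fin (n + 1) => x j = false).card % 2 = 1 ∧ Dk3 x k.val = 1).card =
      (univ.filter fun x : Fin (n + 1) → Bool =>
        (univ.filter fun j : Fin (n + 1) => x j = false).card % 2 = 1 ∧ Q (uVec x)).card := by
    congr 1
    ext x
    simp only [mem_filter, mem_univ, true_and, hQ, dk3_eq_one_iff, stake_eq_affine x hk, hκ]
  rw [hset]
  have hge := card_odd_filter_ge hn Q
  have hQcount := (three_mul_card_affine_mod_three n κ hκ0 (k.val + n + 1) 2).1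
  unfold affCount at hQcount
  have hcomp := Finset.card_filter_add_card_filter_not (s := (univ : Finset (Fin n → Bool))) Q
  rw [card_univ, Fintype.card_fun, Fintype.card_bool, Fintype.card_fin] at hcomp
  have hQcard : (univ.filter fun u : Fin n → Bool => Q u).card =
      (univ.filter fun u : Fin n → Bool =>
        ((k.val + n + 1) + ∑ i : Fin n, (if u i = true then κ i else 0)) % 3 = 2 % 3).card := by
    congr 1; ext u; simp only [mem_filter, mem_univ, true_and, hQ]
  have hnotQ : (univ.filter fun u : Fin n → Bool => ¬ Q u).card + (univ.filter fun u : Fin n → Bool => Q u).card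
      = 2 ^ n := by
    have h' : (Finset.filter Q univ).card = (univ.filter fun u : Fin n → Bool => Q u).card := rfl
    omega
  have hX : (univ.filter fun u : Fin n → Bool =>
        ((k.val + n + 1) + ∑ i : Fin n, (if u i = true then κ i else 0)) % 3 = 2 % 3).card ≤
      (univ.filter fun x : Fin (n + 1) → Bool =>
        (univ.filter fun j : Fin (n + 1) => x j = false).card % 2 = 1 ∧ Q (uVec x)).card := by
    rw [← hQcard]; omega
  have hXz : ((univ.filter fun u : Fin n → Bool =>
        ((k.val + n + 1) + ∑ i : Fin n, (if u i = true then κ i else 0)) % 3 = 2 % 3).card : ℤ) ≤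
      ((univ.filter fun x : Fin (n + 1) → Bool =>
        (univ.filter fun j : Fin (n + 1) => x j = false).card % 2 = 1 ∧ Q (uVec x)).card : ℤ) := by
    exact_mod_cast hX
  linarith

end OddClass

/-! ### P-15a: `OneBellOfPred` -/

/-- The predictor `g_a := 1 + (a − 1)·[w = 1]` (predict `a` where the bell rings, `1` elsewhere). -/
def predOf (w : CubeFn (ZMod 3) N) (a : ZMod 3) : CubeFn (ZMod 3) N :=
  fun x => 1 + (a - 1) * (if w x = 1 then 1 else 0)

/-- `g_a` has degree `≤ 2·deg w`. -/
theorem predOf_mem_lowDeg {D : ℕ} {w : CubeFn (ZMod 3) N} (hw : w ∈ lowDeg (ZMod 3) N D) (a : ZMod 3) :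
    predOf w a ∈ lowDeg (ZMod 3) N (2 * D) := by
  have h1 := ind_eq_one_mem_lowDeg hw
  have heq : predOf w a = 1 + (a - 1) • fun x => if w x = 1 then (1 : ZMod 3) else 0 := by
    funext x
    simp only [predOf, Pi.add_apply, Pi.one_apply, Pi.smul_apply, smul_eq_mul]
  rw [heq]
  exact Submodule.add_mem _ (one_mem_lowDeg _) (Submodule.smul_mem _ _ h1)

/-- Values of `g_a`: `a` on `{w = 1}`, `1` elsewhere. -/
theorem predOf_apply (w : CubeFn (ZMod 3) N) (a : ZMod 3) (x : Fin N → Bool) :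
    predOf w a x = if w x = 1 then a else 1 := by
  unfold predOf
  split_ifs <;> ring

/-- **P-15a `OneBellOfPred` — PROVED**: `PredHardDWB3 → OneBellDWB3`. -/
theorem oneBellOfPred : OneBellOfPred := by
  intro hPred ε hε C
  obtain ⟨n₀, hn₀⟩ := hPred (ε / 4) (by positivity) (C + 1)
  -- `2^N ≥ 16/ε` absorbs the additive constant `4`
  obtain ⟨m₀, hm₀⟩ : ∃ m₀ : ℕ, ∀ N ≥ m₀, (16 : ℝ) / ε ≤ (2 : ℝ) ^ N := by
    obtain ⟨m₀, hm₀⟩ := pow_unbounded_of_one_lt (16 / ε) (by norm_num : (1 : ℝ) < 2)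
    exact ⟨m₀, fun N hN => le_trans hm₀.le (pow_le_pow_right₀ (by norm_num) hN)⟩
  refine ⟨max (max n₀ m₀) 16, fun N hN k w hw => ?_⟩
  have hn₀N : n₀ ≤ N := le_trans (le_trans (le_max_left _ _) (le_max_left _ _)) hN
  have hm₀N : m₀ ≤ N := le_trans (le_trans (le_max_right _ _) (le_max_left _ _)) hN
  have h16 : 16 ≤ N := le_trans (le_max_right _ _) hN
  obtain ⟨n, rfl⟩ : ∃ n, N = n + 1 := ⟨N - 1, by omega⟩
  have hn2 : 2 ≤ n := by omega
  -- degrees of the two predictors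
  have hdeg : ∀ a, predOf w a ∈ lowDeg (ZMod 3) (n + 1) ((Nat.log 2 (n + 1)) ^ (C + 1)) := by
    intro a
    refine lowDeg_mono ?_ (predOf_mem_lowDeg hw a)
    have hlog : 4 ≤ Nat.log 2 (n + 1) := Nat.le_log_of_pow_le (by norm_num) h16
    rw [pow_succ]; nlinarith [Nat.one_le_pow C (Nat.log 2 (n + 1)) (by omega)]
  have hP0 := hn₀ (n + 1) hn₀N k (predOf w 0) (hdeg 0)
  have hP2 := hn₀ (n + 1) hn₀N k (predOf w 2) (hdeg 2)
  -- names for the four odd-class counts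
  set odd : (Fin (n + 1) → Bool) → Prop := fun x =>
    (univ.filter fun j : Fin (n + 1) => x j = false).card % 2 = 1 with hodd
  set A := (univ.filter fun x : Fin (n + 1) → Bool => odd x ∧ w x = 1 ∧ Dk3 x k.val ≠ 1) with hA
  set B := (univ.filter fun x : Fin (n + 1) → Bool => odd x ∧ w x = 1 ∧ Dk3 x k.val = 1) with hB
  set Cc := (univ.filter fun x : Fin (n + 1) → Bool => odd x ∧ ¬ w x = 1 ∧ Dk3 x k.val = 1) with hCc
  -- the agreement set of `g_a` splits as `{w = 1, D = a} ⊔ {w ≠ 1, D = 1}`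
  have hagree : ∀ a : ZMod 3, a ≠ 1 →
      (univ.filter fun x : Fin (n + 1) → Bool => odd x ∧ predOf w a x = Dk3 x k.val).card =
        (univ.filter fun x : Fin (n + 1) → Bool => odd x ∧ w x = 1 ∧ Dk3 x k.val = a).card + Cc.card := by
    intro a ha
    rw [hCc, ← card_union_of_disjoint]
    · congr 1
      ext x
      simp only [mem_filter, mem_univ, true_and, mem_union, predOf_apply]
      constructor
      · rintro ⟨hx, h⟩
        by_cases hw1 : w x = 1
        · rw [if_pos hw1] at h; exact Or.inl ⟨hx, hw1, h.symm⟩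
        · rw [if_neg hw1] at h; exact Or.inr ⟨hx, hw1, h.symm⟩
      · rintro (⟨hx, hw1, h⟩ | ⟨hx, hw1, h⟩)
        · exact ⟨hx, by rw [if_pos hw1, h]⟩
        · exact ⟨hx, by rw [if_neg hw1, h]⟩
    · rw [Finset.disjoint_filter]
      rintro x _ ⟨_, h1, _⟩ ⟨_, h2, _⟩
      exact h2 h1
  -- `A = {w=1, D=0} ⊔ {w=1, D=2}`
  have hAsplit : A.card =
      (univ.filter fun x : Fin (n + 1) → Bool => odd x ∧ w x = 1 ∧ Dk3 x k.val = 0).card +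
      (univ.filter fun x : Fin (n + 1) → Bool => odd x ∧ w x = 1 ∧ Dk3 x k.val = 2).card := by
    rw [hA, ← card_union_of_disjoint]
    · congr 1
      ext x
      simp only [mem_filter, mem_univ, true_and, mem_union]
      have h3 : ∀ d : ZMod 3, d ≠ 1 ↔ (d = 0 ∨ d = 2) := by decide
      rw [h3]
      tauto
    · rw [Finset.disjoint_filter]
      rintro x _ ⟨_, _, h1⟩ ⟨_, _, h2⟩
      rw [h1] at h2
      exact absurd h2 (by decide)
  -- `#{w = 1} = A + B`
  have hS : (univ.filter fun x : Fin (n + 1) → Bool => odd x ∧ w x = 1).card = A.card + B.card := by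
    rw [hA, hB, ← card_union_of_disjoint]
    · congr 1
      ext x
      simp only [mem_filter, mem_univ, true_and, mem_union]
      tauto
    · rw [Finset.disjoint_filter]
      rintro x _ ⟨_, _, h1⟩ ⟨_, _, h2⟩
      exact h1 h2
  -- `#{D = 1} = B + Cc`
  have hD1 : (univ.filter fun x : Fin (n + 1) → Bool => odd x ∧ Dk3 x k.val = 1).card = B.card + Cc.card := by
    rw [hB, hCc, ← card_union_of_disjoint]
    · congr 1
      ext x
      simp only [mem_filter, mem_univ, true_and, mem_union]
      tauto
    · rw [Finset.disjoint_filter]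
      rintro x _ ⟨_, h1, _⟩ ⟨_, h2, _⟩
      exact h2 h1
  have hcount := two_pow_le_three_mul_card_dk3_eq_one hn2 k
  rw [hD1] at hcount
  rw [hagree 0 (by decide)] at hP0
  rw [hagree 2 (by decide)] at hP2
  rw [hS]
  simp only [Nat.add_sub_cancel] at hP0 hP2
  -- real-number bookkeeping
  have hε16 := hm₀ (n + 1) hm₀N
  have hpow : (2 : ℝ) ^ (n + 1) = 2 * (2 : ℝ) ^ n := by ring
  have hcountR : (2 : ℝ) ^ n ≤ 3 * ((B.card : ℝ) + (Cc.card : ℝ)) + 2 := by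
    have : ((2 : ℤ) ^ n : ℝ) ≤ ((3 * ((B.card + Cc.card : ℕ) : ℤ) + 2 : ℤ) : ℝ) := by exact_mod_cast hcount
    push_cast at this
    linarith
  have hA' : (A.card : ℝ) =
      ((univ.filter fun x : Fin (n + 1) → Bool => odd x ∧ w x = 1 ∧ Dk3 x k.val = 0).card : ℝ) +
      ((univ.filter fun x : Fin (n + 1) → Bool => odd x ∧ w x = 1 ∧ Dk3 x k.val = 2).card : ℝ) := by
    rw [hAsplit]; push_cast; ring
  push_cast at hP0 hP2 ⊢
  have hεpow : (16 : ℝ) ≤ ε * (2 : ℝ) ^ (n + 1) := by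
    rw [div_le_iff₀ hε] at hε16; linarith
  nlinarith [hA', hP0, hP2, hcountR, hεpow, hε]

end Summit.QuantumAdvantage.AdviceFreeQNC0

end
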